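/-
Copyright: the b2b-balaban T⁴-continuum CRUX team, row NE7b, leaf prover `t4-ne7b-formalise-leaf-01` (gen 78), for the
OWNER lineage `t4-ne7b-p1` and the refuter desk (PRICING-NE7b F346 ∕ F353: «(A1c) cover routing of births adjacent to live
components»). Project licence.
-/
import Summits.QuantumFields.BalabanUV.T4Continuum.Spine.NE7b.GaussianRankLocalMoment

/-!
# GAUSSIAN RANK-LOCAL MOMENT WITH A PINNED EXTERIOR: β-uniform exactly on a SMALL-FIELD exterior (many variables)

Cell `pub-balaban`, sub-cell `t4`, spine estimate NE7b (`T4WeightBudget.RelWeightBound` — NOT PRINTED, NOT PROVED).  Crux-route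
MODEL work under `Spine/NE7b/`; no `T4Continuum/Support` leaf, no `Prop` minted, no object of [B15]∕[B16] named, no `[cite:]`;
0 `sorry`.

WHY.  `GaussianRankLocalMoment.integral_exp_qf_le` is the centred case: every mode fluctuates under the same Gaussian and the
sacrificed part `δ·xᵀBx` of the action costs `(1−δ)^{−rank B∕2}`, β-free (the OWNER's `GaussianDominatedMoment`, p359207).  When the region's action also sees an EXTERIOR
configuration `m` that is NOT integrated (a neighbouring large-field region born earlier, pinned by the history), the
sacrificed part is `δ·(x − m)ᵀB(x − m)` against the reference Gaussian `e^{−xᵀAx}` — the many-variable form of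
`LocalConditionalStability.gaussian_partial_moment_shift`.  THIS FILE bounds it: for every `ε > 0` with `δ(1+ε) < 1`,
`∫ e^{δ (x−m)ᵀB(x−m)} e^{−xᵀAx} dx ≤ e^{δ(1+ε⁻¹)·mᵀBm} · (√(1−δ(1+ε)))⁻¹ ^ rank B · ∫ e^{−xᵀAx} dx` — rank-local and β-free
EXCEPT through the exterior's own sacrificed action `mᵀBm` (which carries the coupling: `B = β·B₀`), i.e. β-uniform exactly
when the exterior is SMALL-FIELD in the scaled sense `β·mᵀB₀m = O(1)`: the located reason, in the Gaussian model with
correlations, for print's «denominators … determined by small field effective actions only» ([Balaban1989LargeFieldI]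
p. 177 — LOCATOR) and for the refuter's cost item «(A1c) cover routing of births adjacent to live components» (PRICING-NE7b).

WHAT IS PROVED ([folklore]; finite sums and `GaussianRankLocalMoment`):
* §1 `qf_sub_le_young`: the Young split `(x−m)ᵀB(x−m) ≤ (1+ε)·xᵀBx + (1+ε⁻¹)·mᵀBm` for `B` positive semidefinite, `ε > 0`.
* §2 **`integral_exp_qf_shift_le`** (the bound above) and its `LocCondStability`-shaped form `shift_model_locCondStability`
  (integrability + `∫ M·e ≤ e^{b}·∫ e` with `b = δ(1+ε⁻¹)·mᵀBm + rank B·(−log(1−δ(1+ε))∕2)`).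

NOT HERE (honest).  Nothing about Bałaban's densities; no small-field characteristic functions; no normalisation constants (the
`log g⁻²` letter of [B16] p. 380 is not modelled); no inhabitant of `LocCondStability` for the (A1c) instance.  BY-NAME EFFECT ON
THE WALL: NONE.  NE7b NOT PRINTED ∕ NOT PROVED; spine PROVED 0∕9; rung (B)+1 on a FINITE torus — NOT infinite volume, NOT the
mass gap, NOT Clay.
HONEST DEPENDENCY: continuum YM on T⁴ ⇐ BetaPertH ∧ nine spine estimates (0/9 proved); BetaPertH ⇐ (D1) ∧ (D4) ∧ CAP+tail;
G-an2-4 gates asym, D1 and NE2/3/4.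
-/

set_option autoImplicit false

open MeasureTheory Real Matrix Finset
open Summit.QuantumFields.BalabanUV.T4Continuum.NE7b.GaussianDominatedMoment (inv_sqrt_pow_eq_exp)
open Summit.QuantumFields.BalabanUV.T4Continuum.NE7b.GaussianRankLocalMoment

namespace Summit.QuantumFields.BalabanUV.T4Continuum.NE7b.GaussianRankLocalMomentShift

variable {ι : Type} [Fintype ι] [DecidableEq ι]

/-! ## §1 The Young split of a positive-semidefinite quadratic form -/

omit [DecidableEq ι] in
/-- **YOUNG SPLIT.**  For `B` positive semidefinite and `ε > 0`:
`(x − m)ᵀ B (x − m) ≤ (1 + ε)·xᵀBx + (1 + ε⁻¹)·mᵀBm` (from `0 ≤ (εx + m)ᵀ B (εx + m)`). [folklore] -/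
theorem qf_sub_le_young {B : Matrix ι ι ℝ} (hB : B.PosSemidef) (x m : ι → ℝ) {ε : ℝ} (hε : 0 < ε) :
    (x - m) ⬝ᵥ (B *ᵥ (x - m)) ≤ (1 + ε) * (x ⬝ᵥ (B *ᵥ x)) + (1 + ε⁻¹) * (m ⬝ᵥ (B *ᵥ m)) := by
  -- symmetry of the bilinear form (`xᵀBm = mᵀBx`; the tree's `Literature.Geometry.Lorentzian.dotProduct_mulVec_comm_of_isHermitian`
  -- states it — kept inline here to avoid a cross-topic import)
  have hsym : x ⬝ᵥ (B *ᵥ m) = m ⬝ᵥ (B *ᵥ x) := by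
    have hBt : Bᵀ = B := by
      have := hB.1.eq; rwa [conjTranspose_eq_transpose_of_trivial] at this
    rw [dotProduct_mulVec, ← mulVec_transpose, hBt, dotProduct_comm]
  have h0 : 0 ≤ (ε • x + m) ⬝ᵥ (B *ᵥ (ε • x + m)) := by
    simpa only [star_trivial] using hB.dotProduct_mulVec_nonneg (ε • x + m)
  have e1 : (x - m) ⬝ᵥ (B *ᵥ (x - m)) = x ⬝ᵥ (B *ᵥ x) - 2 * (x ⬝ᵥ (B *ᵥ m)) + m ⬝ᵥ (B *ᵥ m) := by
    rw [mulVec_sub, dotProduct_sub, sub_dotProduct, sub_dotProduct, ← hsym]; ring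
  have e2 : (ε • x + m) ⬝ᵥ (B *ᵥ (ε • x + m)) =
      ε ^ 2 * (x ⬝ᵥ (B *ᵥ x)) + 2 * ε * (x ⬝ᵥ (B *ᵥ m)) + m ⬝ᵥ (B *ᵥ m) := by
    rw [mulVec_add, mulVec_smul, dotProduct_add, add_dotProduct, add_dotProduct, smul_dotProduct, smul_dotProduct,
      dotProduct_smul, dotProduct_smul, ← hsym]
    simp only [smul_eq_mul]; ring
  rw [e1]
  rw [e2] at h0
  -- `−2·xᵀBm ≤ ε·xᵀBx + ε⁻¹·mᵀBm`: divide `h0` by `ε`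
  have key : -(2 * (x ⬝ᵥ (B *ᵥ m))) ≤ ε * (x ⬝ᵥ (B *ᵥ x)) + ε⁻¹ * (m ⬝ᵥ (B *ᵥ m)) := by
    have := div_nonneg h0 hε.le
    have hε' : ε ≠ 0 := hε.ne'
    calc -(2 * (x ⬝ᵥ (B *ᵥ m)))
        ≤ -(2 * (x ⬝ᵥ (B *ᵥ m))) + (ε ^ 2 * (x ⬝ᵥ (B *ᵥ x)) + 2 * ε * (x ⬝ᵥ (B *ᵥ m)) + m ⬝ᵥ (B *ᵥ m)) / ε :=
          le_add_of_nonneg_right this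
      _ = ε * (x ⬝ᵥ (B *ᵥ x)) + ε⁻¹ * (m ⬝ᵥ (B *ᵥ m)) := by field_simp; ring
  linarith

/-! ## §2 The shifted moment: rank-local, β-free up to the exterior's own sacrificed action -/

omit [DecidableEq ι] in
/-- The Young split under the exponential: `e^{δ(x−m)ᵀB(x−m)}·e^{−xᵀAx} ≤ e^{δ(1+ε⁻¹)mᵀBm}·(e^{δ(1+ε)xᵀBx}·e^{−xᵀAx})`. [folklore] -/
theorem exp_qf_shift_le_pointwise {B : Matrix ι ι ℝ} (hB : B.PosSemidef) (A : Matrix ι ι ℝ) (x m : ι → ℝ) {δ ε : ℝ}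
    (hδ0 : 0 ≤ δ) (hε : 0 < ε) :
    exp (δ * ((x - m) ⬝ᵥ (B *ᵥ (x - m)))) * exp (-(x ⬝ᵥ (A *ᵥ x))) ≤
      exp (δ * (1 + ε⁻¹) * (m ⬝ᵥ (B *ᵥ m))) * (exp (δ * (1 + ε) * (x ⬝ᵥ (B *ᵥ x))) * exp (-(x ⬝ᵥ (A *ᵥ x)))) := by
  rw [← mul_assoc, ← Real.exp_add (δ * (1 + ε⁻¹) * (m ⬝ᵥ (B *ᵥ m)))]
  refine mul_le_mul_of_nonneg_right (exp_le_exp.2 ?_) (exp_pos _).le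
  have := mul_le_mul_of_nonneg_left (qf_sub_le_young hB x m hε) hδ0
  linarith

/-- **GAUSSIAN RANK-LOCAL MOMENT WITH A PINNED EXTERIOR.**  `A.PosDef`, `B.PosSemidef`, `(A − B).PosSemidef`, `0 ≤ δ`, `0 < ε`,
`δ(1+ε) < 1` ⊢ `∫ e^{δ (x−m)ᵀB(x−m)} e^{−xᵀAx} dx ≤ e^{δ(1+ε⁻¹)·mᵀBm} · (√(1−δ(1+ε)))⁻¹ ^ rank B · ∫ e^{−xᵀAx} dx`.
β-uniform IF `mᵀBm = O(1)` (the exterior is small-field in the scaled sense; the converse holds by the exact formula — refuter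
F362 (w1) — and is not proved here). [folklore] -/
theorem integral_exp_qf_shift_le {A B : Matrix ι ι ℝ} (hA : A.PosDef) (hB : B.PosSemidef) (hAB : (A - B).PosSemidef)
    (m : ι → ℝ) {δ ε : ℝ} (hδ0 : 0 ≤ δ) (hε : 0 < ε) (hδε : δ * (1 + ε) < 1) :
    ∫ x : ι → ℝ, exp (δ * ((x - m) ⬝ᵥ (B *ᵥ (x - m)))) * exp (-(x ⬝ᵥ (A *ᵥ x))) ≤
      exp (δ * (1 + ε⁻¹) * (m ⬝ᵥ (B *ᵥ m))) * ((√(1 - δ * (1 + ε)))⁻¹ ^ B.rank *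
        ∫ x : ι → ℝ, exp (-(x ⬝ᵥ (A *ᵥ x)))) := by
  have hδ' : 0 ≤ δ * (1 + ε) := by positivity
  -- pointwise Young split, then the centred theorem at the sacrificed fraction `δ(1+ε)`
  calc ∫ x : ι → ℝ, exp (δ * ((x - m) ⬝ᵥ (B *ᵥ (x - m)))) * exp (-(x ⬝ᵥ (A *ᵥ x)))
      ≤ ∫ x : ι → ℝ, exp (δ * (1 + ε⁻¹) * (m ⬝ᵥ (B *ᵥ m))) *
          (exp (δ * (1 + ε) * (x ⬝ᵥ (B *ᵥ x))) * exp (-(x ⬝ᵥ (A *ᵥ x)))) :=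
        integral_mono_of_nonneg (Filter.Eventually.of_forall fun x => by positivity)
          ((integrable_exp_qf hA hB hAB hδ' hδε).const_mul _)
          (Filter.Eventually.of_forall fun x => exp_qf_shift_le_pointwise hB A x m hδ0 hε)
    _ ≤ _ := by
        rw [integral_const_mul]
        exact mul_le_mul_of_nonneg_left (integral_exp_qf_le hA hB hAB hδ' hδε) (exp_pos _).le

/-- **IN `LocCondStability`'s SHAPE, WITH THE EXTERIOR.**  Carrier `M = e^{δ (x−m)ᵀB(x−m)}`, term `e = e^{−xᵀAx}`: `M·e` is
integrable and `∫ M·e ≤ e^{b}·∫ e` with `b = δ(1+ε⁻¹)·mᵀBm + rank B·(−log(1−δ(1+ε))∕2)` — the region's term is β-free, the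
exterior's term is β·(its own sacrificed action). [folklore] -/
theorem shift_model_locCondStability {A B : Matrix ι ι ℝ} (hA : A.PosDef) (hB : B.PosSemidef) (hAB : (A - B).PosSemidef)
    (m : ι → ℝ) {δ ε : ℝ} (hδ0 : 0 ≤ δ) (hε : 0 < ε) (hδε : δ * (1 + ε) < 1) :
    Integrable (fun x : ι → ℝ => exp (δ * ((x - m) ⬝ᵥ (B *ᵥ (x - m)))) * exp (-(x ⬝ᵥ (A *ᵥ x)))) ∧
      ∫ x : ι → ℝ, exp (δ * ((x - m) ⬝ᵥ (B *ᵥ (x - m)))) * exp (-(x ⬝ᵥ (A *ᵥ x))) ≤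
        exp (δ * (1 + ε⁻¹) * (m ⬝ᵥ (B *ᵥ m)) + (B.rank : ℝ) * (-Real.log (1 - δ * (1 + ε)) / 2)) *
          ∫ x : ι → ℝ, exp (-(x ⬝ᵥ (A *ᵥ x))) := by
  have hδ' : 0 ≤ δ * (1 + ε) := by positivity
  refine ⟨?_, ?_⟩
  · -- dominated by `e^{δ(1+ε⁻¹)mᵀBm} · (e^{δ(1+ε)xᵀBx} e^{−xᵀAx})`, continuous
    refine ((integrable_exp_qf hA hB hAB hδ' hδε).const_mul (exp (δ * (1 + ε⁻¹) * (m ⬝ᵥ (B *ᵥ m))))).mono'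
      (by fun_prop) (Filter.Eventually.of_forall fun x => ?_)
    rw [Real.norm_eq_abs, abs_of_nonneg (by positivity)]
    exact exp_qf_shift_le_pointwise hB A x m hδ0 hε
  · rw [Real.exp_add, ← inv_sqrt_pow_eq_exp hδε B.rank, mul_assoc]
    exact integral_exp_qf_shift_le hA hB hAB m hδ0 hε hδε

end Summit.QuantumFields.BalabanUV.T4Continuum.NE7b.GaussianRankLocalMomentShift
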